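/-
Fleet lead `ym-wcr-19609-p1` (seat prover-ym-wcr-19609-p1-g2-0), route `WeakCouplingRates`, crux `BulkDominatesColdBoxW`
(stmt-QuantumFields-19609), line `dlr-chessboard` (v8): every link of the SHIFTED glued Dirichlet field is small when its circulations are (goodTD sandwich, step 1).
-/
import Summits.QuantumFields.YangMills.Theorems.WeakCouplingRatesBulkDominatesColdBoxWForestPoincareLinearDatum
import Summits.QuantumFields.YangMills.Theorems.WeakCouplingRatesColdBoxGaussTail
import Summits.QuantumFields.YangMills.Theorems.WeakCouplingRatesColdBoxOneScaleDatumDefs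
import Summits.QuantumFields.YangMills.Theorems.WeakCouplingRatesColdBoxDirichletShiftedMean

/-!
# Crux `BulkDominatesColdBoxW`, expansion stubs: link smallness of the shifted glued field from circulation smallness (goodTD sandwich, step 1)

For the scaled datum `ϑ' = sdat β ϑ` (`…OneScaleDatumDefs`) and one colour `c`, the glued edge function
`A_c = glue ϑ'_c (mean ϑ'_c + t_c)` has circulations `F'_c(p) + dirCirc H p (t_c)` (`sCirc_glue_add_ofLp`).  If `|dirCirc_p(t_c)| ≤ R` and
`|F'_c(p)| ≤ R'` on every genuine plaquette, `Σ_c ϑ_c(e)² ≤ r²` off the cold box and `ϑ = 0` on the temporal forest, then by the linear ladder with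
exterior datum (`abs_le_of_sCirc_le_of_exterior_le`, p481921): `|A_c e| ≤ (12H²+2H+1)((R + R') + 4√(2β)·r)` for every edge
(`abs_glue_sdat_shift_le`).  This is step 1 of the datum twin of `smallField_subset_goodT`.  No new definition; standard axioms.  NOT a claim about
the mass gap.
-/

set_option autoImplicit false

noncomputable section

open Finset
open Literature.Probability.LatticeModels Literature.MathematicalPhysics.QuantumLattice
open Literature.MathematicalPhysics.QuantumFieldTheory Literature.MathematicalPhysics.QuantumFieldTheory.AxialGauge
open Literature.MathematicalPhysics.QuantumFieldTheory.LatticeMaxwell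

namespace Summit.QuantumFields.YangMills.Theorems.WeakCouplingRates

variable {H : ℕ}

/-- One component is bounded by the Euclidean size: `|v c| ≤ r` if `Σ_c v_c² ≤ r²`, `r ≥ 0`. -/
theorem abs_apply_le_of_sum_sq_le {v : Fin 3 → ℝ} {r : ℝ} (hr : 0 ≤ r) (hv : ∑ c, v c ^ 2 ≤ r ^ 2) (c : Fin 3) : |v c| ≤ r := by
  have h1 : v c ^ 2 ≤ ∑ c', v c' ^ 2 := Finset.single_le_sum (f := fun c' => v c' ^ 2) (fun c' _ => sq_nonneg _) (Finset.mem_univ c)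
  exact abs_le_of_sq_le_sq' (by linarith) hr |>.elim (fun h h' => abs_le.2 ⟨h, h'⟩)

/-- **Link smallness of the shifted glued field** (goodTD sandwich, step 1). -/
theorem abs_glue_sdat_shift_le {β : ℝ} (hH : 1 ≤ H)
    {ϑ : Fin 3 → Literature.MathematicalPhysics.QuantumLattice.ZdEdge 4 → ℝ} {r R R' : ℝ} (hr : 0 ≤ r) (hR : 0 ≤ R) (hR' : 0 ≤ R')
    (hϑ : ∀ e, e ∉ boxEdges 4 (2 * H + 1) → ∑ c, ϑ c e ^ 2 ≤ r ^ 2)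
    (hforest : ∀ x : Site 4, (∀ k : Fin 4, 1 ≤ x k ∧ x k + 1 ≤ 2 * (H : ℤ)) → ∀ c, ϑ c (x, 0) = 0)
    (c : Fin 3) {t : TSpace H}
    (ht : ∀ p : ZdPlaquette 4, |dirCirc H (p.1, p.2.1.1, p.2.1.2) (t c)| ≤ R)
    (hF : ∀ p : ZdPlaquette 4, |sCirc (glue (pin := fun e => e ∉ dirFreeEdges H) dirCorner (2 * H + 3) (sdat β ϑ c)
        (mean (fun e => e ∉ dirFreeEdges H) dirCorner (2 * H + 3) (sdat β ϑ c))) (p.1, p.2.1.1, p.2.1.2)| ≤ R')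
    (e : Literature.MathematicalPhysics.QuantumLattice.ZdEdge 4) :
    |glue (pin := fun e => e ∉ dirFreeEdges H) dirCorner (2 * H + 3) (sdat β ϑ c)
        (mean (fun e => e ∉ dirFreeEdges H) dirCorner (2 * H + 3) (sdat β ϑ c) + WithLp.ofLp (t c)) e| ≤
      (12 * (H : ℝ) ^ 2 + 2 * H + 1) * ((R + R') + 4 * (Real.sqrt (2 * β) * r)) := by
  have hsr : 0 ≤ Real.sqrt (2 * β) * r := mul_nonneg (Real.sqrt_nonneg _) hr
  refine abs_le_of_sCirc_le_of_exterior_le hH _ hsr ?_ ?_ ?_ e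
  · -- exterior: `|A e| = √(2β)|ϑ c e| ≤ √(2β) r` on the collar, `0` off the enlarged box
    intro e' he'
    by_cases hE : e' ∈ boxEdgesAt dirCorner (2 * H + 3)
    · have hpin : e' ∉ dirFreeEdges H := fun h => he' (mem_dirFreeEdges.1 h).1
      rw [glue_apply_pin _ _ hE hpin, sdat_apply, abs_mul, abs_of_nonneg (Real.sqrt_nonneg _)]
      exact mul_le_mul_of_nonneg_left (abs_apply_le_of_sum_sq_le hr (hϑ e' he') c) (Real.sqrt_nonneg _)
    · rw [glue_apply_of_not_mem _ _ hE, abs_zero]; exact hsr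
  · -- forest: pinned, `ϑ = 0` there
    intro x hx
    have hmem : ((x, (0 : Fin 4)) : Literature.MathematicalPhysics.QuantumLattice.ZdEdge 4) ∈ boxEdges 4 (2 * H + 1) := by
      rw [mem_boxEdges_iff]
      exact ⟨fun k => by have := hx k; constructor <;> push_cast <;> omega, by have := hx 0; push_cast; omega⟩
    have hE : ((x, (0 : Fin 4)) : Literature.MathematicalPhysics.QuantumLattice.ZdEdge 4) ∈ boxEdgesAt dirCorner (2 * H + 3) :=
      boxEdges_subset_boxEdgesAt_dirCorner H hmem
    have hpin : ((x, (0 : Fin 4)) : Literature.MathematicalPhysics.QuantumLattice.ZdEdge 4) ∉ dirFreeEdges H := fun h =>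
      (mem_dirFreeEdges.1 h).2 ⟨rfl, fun k => by have := hx k; exact ⟨this.1, by exact_mod_cast this.2⟩⟩
    rw [glue_apply_pin _ _ hE hpin, sdat_apply, hforest x hx c, mul_zero]
  · -- circulations: `F'_c(p) + dirCirc_p(t_c)`
    have hRR : 0 ≤ R + R' := by linarith
    refine abs_sCirc_le_of_forall_zdPlaquette _ hRR fun p => ?_
    rw [sCirc_glue_add_ofLp]
    calc |sCirc (glue (pin := fun e => e ∉ dirFreeEdges H) dirCorner (2 * H + 3) (sdat β ϑ c)
            (mean (fun e => e ∉ dirFreeEdges H) dirCorner (2 * H + 3) (sdat β ϑ c))) (p.1, p.2.1.1, p.2.1.2) +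
            dirCirc H (p.1, p.2.1.1, p.2.1.2) (t c)|
        ≤ |sCirc (glue (pin := fun e => e ∉ dirFreeEdges H) dirCorner (2 * H + 3) (sdat β ϑ c)
            (mean (fun e => e ∉ dirFreeEdges H) dirCorner (2 * H + 3) (sdat β ϑ c))) (p.1, p.2.1.1, p.2.1.2)| +
            |dirCirc H (p.1, p.2.1.1, p.2.1.2) (t c)| := abs_add_le _ _
      _ ≤ R' + R := add_le_add (hF p) (ht p)
      _ = R + R' := add_comm _ _

end Summit.QuantumFields.YangMills.Theorems.WeakCouplingRates

end
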